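import Summits.QuantumAdvantage.QuantumAdvantage.Theorems.SosSandwichPseudoBoundedTopPairingContractionPadded
import HarnessLib

/-!
# Crux `PseudoBoundedAA` (stmt-QuantumAdvantage-15237) / item `HomogeneousPBAAT` (stmt-27399): which strengthening of
# the contraction line survives — the TWO-CERTIFICATE uniform bound still forces top-level AA on Boolean functions

Fourth part of the calibration (`…TopPairingContraction`, `…Padded`, `…Homogeneous`).  Those files show that the
uniform contraction bound over data with ONE certificate (`Σ_j q_j² ≤ 1`) forces top-level Aaronson–Ambainis for all
bounded polynomials.  The natural repair is to demand GENUINE membership `p = Σ_j q_j² ∈ K_T` (both SOS certificates,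
`PseudoBounded T p`) while keeping the weights `c` arbitrary — hypothesis (H2) below.  This file records what (H2)
still costs, through a per-polynomial form of the padding argument:

* `exists_topRow_ge_of_contraction_padded` — for ONE polynomial `g` (degree `≤ T`, `g² ≤ 1` on the cube,
  `W^{=T}[g] > 0`): if the contraction estimate with constant `K` holds for every PADDED datum
  `rename (Fin.natAdd n₁) g` (all `n₁`), then `∃ k, (W^{=T}[g])² ≤ K · Σ_{|S|=T, S∋k} ĝ(S)²`;
* `exists_topRow_ge_of_twoCertContraction_boolean` — **(H2) ⟹ top-level AA for every `±1`-VALUED `g` of degree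
  `≤ T`** (`∃ k, (W^{=T}[g])² ≤ K(T)·Σ_{|S|=T,S∋k} ĝ(S)²`): the constant `p = g² = 1` IS a member of `K_T`
  (`1 = 1²`, `1 − 1 = 0²`) whose datum `q = g` carries `ĝ` at the top level; `…_influence` form `4W² ≤ K(T)·Inf_k`.

Calibration value (planner / disprover): (H2) transfers NO AA-hardness beyond the BOOLEAN top level — its cheapest
falsifier is a `±1`-valued degree-`T` family with top weight `W^{=T} ≥ T^{-O(1)}` and all top-level influences
`Σ_{S∋k,|S|=T} ĝ(S)² ≤ W²·T^{-ω(1)}` (the composed address family gives ratio exactly `T`, matching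
`TopPairing.contraction_ge_of_addr`); for top-HOMOGENEOUS Boolean `g` the conclusion is ordinary AA for Boolean functions
(true with polynomial loss, cf. `Theorems/SosSandwichPseudoBoundedAABooleanCornerOSSS.lean`).  So, unlike (H1), (H2) is
not known to be harder than the crux; it stays a candidate line, with `K ≥ T/4` forced.  Honest label: calibration
(hypothesis ⟹ consequence); proves neither 27399 nor the crux; no registered stub is closed.  Finite sums; no named facts.
Sources: EscuderoGutierrez2023 (arXiv:2304.06713) Question 4.5; KaniewskiLeeDewolf2015 Def. 7 (the class `K_T`);
AaronsonAmbainis2014 Conj. 6; ODonnell2014 §2.2.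
-/

set_option linter.dupNamespace false

noncomputable section

namespace Summit.QuantumAdvantage.QuantumAdvantage.Theorems.SosSandwich

open Finset MvPolynomial Literature.Computability.QuantumComplexity
open Literature.Computability.Complexity.LowDegree Literature.Probability.RandomGraphs.LowDegree

namespace TopPairing

variable {N : ℕ}

/-- **Padding, per polynomial.**  If every padded datum `rename (Fin.natAdd n₁) g` of a fixed `g` (`T ≥ 1`, positive
top weight at level `T`; no degree or boundedness hypothesis is needed for this step) obeys the contraction estimate
with constant `K`, then `∃ k, (W^{=T}[g])² ≤ K·Σ_{|S|=T, S∋k} ĝ(S)²`.  (Proof of `exists_topRow_ge_of_uniformContraction`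
with the hypothesis localised at `g`.) [cite: EscuderoGutierrez2023, Question 4.5] -/
theorem exists_topRow_ge_of_contraction_padded (K : ℝ) {T : ℕ} (hT : 1 ≤ T) (g : MvPolynomial (Fin N) ℝ)
    (hK : ∀ (n₁ : ℕ) (c : Finset (Fin (n₁ + N)) → ℝ) (M : ℝ),
      (∀ k : Fin (n₁ + N), ∑ U ∈ Finset.univ.filter (fun U : Finset (Fin (n₁ + N)) => U.card = 2 * T ∧ k ∈ U),
          c U ^ 2 ≤ M) →
      ∑ R ∈ Finset.univ.filter (fun R : Finset (Fin (n₁ + N)) => R.card = T),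
        (∑ U ∈ Finset.univ.filter (fun U : Finset (Fin (n₁ + N)) => U.card = 2 * T ∧ R ⊆ U),
          c U * cubeFourierCoeff (evalBool (rename (Fin.natAdd n₁) g)) (U \ R)) ^ 2 ≤ K * M)
    (hW : 0 < ∑ S ∈ Finset.univ.filter (fun S : Finset (Fin N) => S.card = T), cubeFourierCoeff (evalBool g) S ^ 2) :
    ∃ k : Fin N, (∑ S ∈ Finset.univ.filter (fun S : Finset (Fin N) => S.card = T),
        cubeFourierCoeff (evalBool g) S ^ 2) ^ 2 ≤
      K * ∑ S ∈ Finset.univ.filter (fun S : Finset (Fin N) => S.card = T ∧ k ∈ S),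
        cubeFourierCoeff (evalBool g) S ^ 2 := by
  classical
  set a : Finset (Fin N) → ℝ := fun S => cubeFourierCoeff (evalBool g) S with ha
  set W := ∑ S ∈ Finset.univ.filter (fun S : Finset (Fin N) => S.card = T), a S ^ 2 with hWdef
  obtain ⟨S₀, hS₀, hS₀ne⟩ : ∃ S ∈ Finset.univ.filter (fun S : Finset (Fin N) => S.card = T), a S ^ 2 ≠ 0 := by
    by_contra hcon
    push Not at hcon
    exact hW.ne' (Finset.sum_eq_zero hcon)
  have hS₀T : S₀.card = T := (Finset.mem_filter.mp hS₀).2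
  obtain ⟨k₀, hk₀⟩ : S₀.Nonempty := by rw [← Finset.card_pos, hS₀T]; omega
  set row : Fin N → ℝ := fun k =>
    ∑ S ∈ Finset.univ.filter (fun S : Finset (Fin N) => S.card = T ∧ k ∈ S), a S ^ 2 with hrow
  obtain ⟨k₁, -, hk₁⟩ := Finset.exists_max_image Finset.univ row ⟨k₀, Finset.mem_univ _⟩
  refine ⟨k₁, ?_⟩
  set μ := row k₁ with hμdef
  have hμpos : 0 < μ := by
    have h1 : a S₀ ^ 2 ≤ row k₀ :=
      Finset.single_le_sum (f := fun S => a S ^ 2) (fun S _ => sq_nonneg _)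
        (Finset.mem_filter.mpr ⟨Finset.mem_univ _, hS₀T, hk₀⟩)
    have h2 : 0 < a S₀ ^ 2 := lt_of_le_of_ne (sq_nonneg _) (Ne.symm hS₀ne)
    exact lt_of_lt_of_le (lt_of_lt_of_le h2 h1) (hk₁ k₀ (Finset.mem_univ _))
  obtain ⟨n₁, hn₁T, hn₁⟩ : ∃ n₁ : ℕ, T ≤ n₁ ∧ (T : ℝ) * W ≤ (n₁ : ℝ) * μ := by
    obtain ⟨n, hn⟩ := exists_nat_ge ((T : ℝ) * W / μ)
    refine ⟨n + T, by omega, ?_⟩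
    rw [div_le_iff₀ hμpos] at hn
    have hT0 : (0 : ℝ) ≤ (T : ℝ) * μ := mul_nonneg (Nat.cast_nonneg T) hμpos.le
    have hexp : (((n + T : ℕ) : ℝ)) * μ = (n : ℝ) * μ + (T : ℝ) * μ := by push_cast; ring
    rw [hexp]
    linarith
  set g' : MvPolynomial (Fin (n₁ + N)) ℝ := rename (Fin.natAdd n₁) g with hg'
  set X : Finset (Fin (n₁ + N)) :=
    (Finset.univ : Finset (Fin n₁)).map (Fin.castAddEmb N) with hXdef
  have hXcard : X.card = n₁ := by rw [hXdef, Finset.card_map, Finset.card_univ, Fintype.card_fin]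
  have hidle : ∀ k ∈ X, ∀ z, evalBool g' (flipBit k z) = evalBool g' z := by
    intro k hk z
    rw [hXdef, Finset.mem_map] at hk
    obtain ⟨i, -, rfl⟩ := hk
    show evalBool (rename (Fin.natAdd n₁) g) (flipBit (Fin.castAdd N i) z) = evalBool (rename (Fin.natAdd n₁) g) z
    rw [evalBool_rename_natAdd, evalBool_rename_natAdd, flipBit_castAdd_comp_natAdd]
  have hF : ∀ (S' : Finset (Fin (n₁ + N))) (i : Fin n₁), Fin.castAdd N i ∈ S' →
      cubeFourierCoeff (evalBool g') S' ^ 2 = 0 := by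
    intro S' i hi
    show cubeFourierCoeff (evalBool (rename (Fin.natAdd n₁) g)) S' ^ 2 = 0
    rw [cubeFourierCoeff_pad_eq_zero g hi, sq, mul_zero]
  have hcoef : ∀ S : Finset (Fin N), cubeFourierCoeff (evalBool g') (S.map (Fin.natAddEmb n₁)) = a S := fun S => by
    show cubeFourierCoeff (evalBool (rename (Fin.natAdd n₁) g)) (S.map (Fin.natAddEmb n₁)) =
      cubeFourierCoeff (evalBool g) S
    exact cubeFourierCoeff_pad_map g S
  have hW' : ∑ S' ∈ Finset.univ.filter (fun S' : Finset (Fin (n₁ + N)) => S'.card = T),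
      cubeFourierCoeff (evalBool g') S' ^ 2 = W := by
    rw [sum_pad_eq (fun S' => cubeFourierCoeff (evalBool g') S' ^ 2) hF (fun S' => S'.card = T)]
    simp_rw [Finset.card_map, hcoef]
    rfl
  have hrow' : ∀ k' : Fin (n₁ + N),
      ∑ S' ∈ Finset.univ.filter (fun S' : Finset (Fin (n₁ + N)) => S'.card = T ∧ k' ∈ S'),
        cubeFourierCoeff (evalBool g') S' ^ 2 ≤ μ := by
    intro k'
    rw [sum_pad_eq (fun S' => cubeFourierCoeff (evalBool g') S' ^ 2) hF (fun S' => S'.card = T ∧ k' ∈ S')]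
    simp_rw [Finset.card_map, hcoef]
    rcases castAdd_or_natAdd k' with ⟨i, rfl⟩ | ⟨j, rfl⟩
    · have hempty : ∀ S : Finset (Fin N), ¬ (S.card = T ∧ Fin.castAdd N i ∈ S.map (Fin.natAddEmb n₁)) := by
        rintro S ⟨-, hS⟩
        rw [Finset.mem_map] at hS
        obtain ⟨j, -, hj⟩ := hS
        change Fin.natAdd n₁ j = Fin.castAdd N i at hj
        have hv := congrArg Fin.val hj
        simp only [Fin.val_natAdd, Fin.val_castAdd] at hv
        omega
      rw [Finset.filter_false_of_mem (fun S _ => hempty S), Finset.sum_empty]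
      exact hμpos.le
    · have hmem : ∀ S : Finset (Fin N), (Fin.natAdd n₁ j ∈ S.map (Fin.natAddEmb n₁) ↔ j ∈ S) := fun S =>
        Finset.mem_map' (Fin.natAddEmb n₁)
      simp_rw [hmem]
      exact hk₁ j (Finset.mem_univ _)
  have hmain := topWeight_sq_le_of_contraction_of_idle hT K g' (hK n₁) X hidle
    (by rw [hXcard]; exact hn₁T) μ hrow' (by rw [hW', hXcard]; exact hn₁)
  rw [hW'] at hmain
  exact hmain

/-- **The two-certificate uniform contraction bound (H2) still forces top-level AA on every `±1`-valued polynomial.**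
(H2): the contraction estimate with constant `K T` for ALL weights and ALL data `(q_j)` of degrees `≤ T` whose
square-sum `p = Σ_j q_j²` is a GENUINE member of `K_T` (`PseudoBounded T p`, both SOS certificates).  Then every `g`
of total degree `≤ T` (`T ≥ 1`) with `g(x)² = 1` on the cube and `W^{=T}[g] > 0` has
`∃ k, (W^{=T}[g])² ≤ K T · Σ_{|S|=T, S∋k} ĝ(S)²`: the constant `p = g² = 1` is pseudo-bounded of every order
(`1 = 1²`, `0 = 0²`) with datum `q = g`. [cite: KaniewskiLeeDewolf2015, Def. 7] [cite: EscuderoGutierrez2023, Question 4.5] -/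
theorem exists_topRow_ge_of_twoCertContraction_boolean (K : ℕ → ℝ)
    (h2 : ∀ (N T m : ℕ) (q : Fin m → MvPolynomial (Fin N) ℝ) (p : MvPolynomial (Fin N) ℝ), 1 ≤ T →
      (∀ j, (q j).totalDegree ≤ T) → (∀ x, evalBool p x = ∑ j, evalBool (q j) x ^ 2) →
      PseudoBounded T p →
      ∀ (c : Finset (Fin N) → ℝ) (M : ℝ),
        (∀ k : Fin N, ∑ U ∈ Finset.univ.filter (fun U : Finset (Fin N) => U.card = 2 * T ∧ k ∈ U), c U ^ 2 ≤ M) →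
        ∑ j, ∑ R ∈ Finset.univ.filter (fun R : Finset (Fin N) => R.card = T),
          (∑ U ∈ Finset.univ.filter (fun U : Finset (Fin N) => U.card = 2 * T ∧ R ⊆ U),
            c U * cubeFourierCoeff (evalBool (q j)) (U \ R)) ^ 2 ≤ K T * M)
    {T : ℕ} (hT : 1 ≤ T) (g : MvPolynomial (Fin N) ℝ) (hg : g.totalDegree ≤ T)
    (hbool : ∀ x, evalBool g x ^ 2 = 1)
    (hW : 0 < ∑ S ∈ Finset.univ.filter (fun S : Finset (Fin N) => S.card = T), cubeFourierCoeff (evalBool g) S ^ 2) :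
    ∃ k : Fin N, (∑ S ∈ Finset.univ.filter (fun S : Finset (Fin N) => S.card = T),
        cubeFourierCoeff (evalBool g) S ^ 2) ^ 2 ≤
      K T * ∑ S ∈ Finset.univ.filter (fun S : Finset (Fin N) => S.card = T ∧ k ∈ S),
        cubeFourierCoeff (evalBool g) S ^ 2 := by
  refine exists_topRow_ge_of_contraction_padded (K T) hT g ?_ hW
  intro n₁ c M hcM
  -- the padded datum `q = g'`, `p = g'² = 1 ∈ K_T`
  have hval : ∀ z : Fin (n₁ + N) → Bool, evalBool (rename (Fin.natAdd n₁) g ^ 2) z = 1 := by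
    intro z
    have h1 : evalBool (rename (Fin.natAdd n₁) g ^ 2) z = evalBool (rename (Fin.natAdd n₁) g) z ^ 2 := by
      unfold evalBool; exact map_pow _ _ _
    rw [h1, evalBool_rename_natAdd]
    exact hbool _
  have hsq : ∀ z, evalBool (rename (Fin.natAdd n₁) g ^ 2) z =
      ∑ j : Fin 1, evalBool ((fun _ : Fin 1 => rename (Fin.natAdd n₁) g) j) z ^ 2 := fun z => by
    rw [Fin.sum_univ_one]; unfold evalBool; exact map_pow _ _ _
  have hpb : PseudoBounded T (rename (Fin.natAdd n₁) g ^ 2) := by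
    refine ⟨1, fun _ => 1, fun _ => 0, fun _ => ⟨?_, ?_⟩, fun z => ⟨?_, ?_⟩⟩
    · rw [totalDegree_one]; exact Nat.zero_le _
    · rw [totalDegree_zero]; exact Nat.zero_le _
    · have := hval z
      unfold evalBool at this
      rw [Fin.sum_univ_one, this, map_one, one_pow]
    · have := hval z
      unfold evalBool at this
      rw [Fin.sum_univ_one, this, map_zero]
      ring
  have := h2 (n₁ + N) T 1 (fun _ => rename (Fin.natAdd n₁) g) (rename (Fin.natAdd n₁) g ^ 2) hT
    (fun _ => (totalDegree_rename_le _ _).trans hg) hsq hpb c M hcM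
  simpa only [Fin.sum_univ_one] using this

/-- Influence form of the preceding: under (H2), every `±1`-valued `g` of degree `≤ T` with `W^{=T}[g] > 0` has a
variable with `4·(W^{=T}[g])² ≤ K T · Inf_k[g]` (`K T ≥ 0`). [cite: ODonnell2014, §2.2] -/
theorem exists_influence_ge_of_twoCertContraction_boolean (K : ℕ → ℝ)
    (h2 : ∀ (N T m : ℕ) (q : Fin m → MvPolynomial (Fin N) ℝ) (p : MvPolynomial (Fin N) ℝ), 1 ≤ T →
      (∀ j, (q j).totalDegree ≤ T) → (∀ x, evalBool p x = ∑ j, evalBool (q j) x ^ 2) →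
      PseudoBounded T p →
      ∀ (c : Finset (Fin N) → ℝ) (M : ℝ),
        (∀ k : Fin N, ∑ U ∈ Finset.univ.filter (fun U : Finset (Fin N) => U.card = 2 * T ∧ k ∈ U), c U ^ 2 ≤ M) →
        ∑ j, ∑ R ∈ Finset.univ.filter (fun R : Finset (Fin N) => R.card = T),
          (∑ U ∈ Finset.univ.filter (fun U : Finset (Fin N) => U.card = 2 * T ∧ R ⊆ U),
            c U * cubeFourierCoeff (evalBool (q j)) (U \ R)) ^ 2 ≤ K T * M)
    (hK0 : ∀ T, 0 ≤ K T)
    {T : ℕ} (hT : 1 ≤ T) (g : MvPolynomial (Fin N) ℝ) (hg : g.totalDegree ≤ T)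
    (hbool : ∀ x, evalBool g x ^ 2 = 1)
    (hW : 0 < ∑ S ∈ Finset.univ.filter (fun S : Finset (Fin N) => S.card = T), cubeFourierCoeff (evalBool g) S ^ 2) :
    ∃ k : Fin N, 4 * (∑ S ∈ Finset.univ.filter (fun S : Finset (Fin N) => S.card = T),
        cubeFourierCoeff (evalBool g) S ^ 2) ^ 2 ≤ K T * influence k g := by
  classical
  obtain ⟨k, hk⟩ := exists_topRow_ge_of_twoCertContraction_boolean K h2 hT g hg hbool hW
  refine ⟨k, ?_⟩
  rw [influence_eq_sum_sq_fourier]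
  have hsub : ∑ S ∈ Finset.univ.filter (fun S : Finset (Fin N) => S.card = T ∧ k ∈ S),
      cubeFourierCoeff (evalBool g) S ^ 2 ≤
      ∑ S ∈ Finset.univ.filter (fun S : Finset (Fin N) => k ∈ S), cubeFourierCoeff (evalBool g) S ^ 2 :=
    Finset.sum_le_sum_of_subset_of_nonneg
      (fun S hS => by
        rw [Finset.mem_filter] at hS ⊢
        exact ⟨hS.1, hS.2.2⟩)
      fun S _ _ => sq_nonneg _
  calc 4 * (∑ S ∈ Finset.univ.filter (fun S : Finset (Fin N) => S.card = T),
          cubeFourierCoeff (evalBool g) S ^ 2) ^ 2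
      ≤ 4 * (K T * ∑ S ∈ Finset.univ.filter (fun S : Finset (Fin N) => S.card = T ∧ k ∈ S),
          cubeFourierCoeff (evalBool g) S ^ 2) := by linarith
    _ ≤ 4 * (K T * ∑ S ∈ Finset.univ.filter (fun S : Finset (Fin N) => k ∈ S),
          cubeFourierCoeff (evalBool g) S ^ 2) :=
        mul_le_mul_of_nonneg_left (mul_le_mul_of_nonneg_left hsub (hK0 T)) (by norm_num)
    _ = K T * (4 * ∑ S ∈ Finset.univ.filter (fun S : Finset (Fin N) => k ∈ S),
          cubeFourierCoeff (evalBool g) S ^ 2) := by ring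

end TopPairing

end Summit.QuantumAdvantage.QuantumAdvantage.Theorems.SosSandwich

end
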